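import Literature.Algebra.Homology.DiscreteRepLayerRestriction
import HarnessLib

/-!
# Pull-back along a continuous homomorphism READ ON THE LAYERS of `(d)`: `φ^* ∘ Inf_V = Inf_{φ⁻¹V} ∘ φ̄^*`
# (Serre, *Galois Cohomology* I §2.2 Prop. 8, §2.4; Harari §1.5 Definition 1.33, §4.3 (2)–(3))

Topic `Algebra/Homology`; namespace `Literature.Algebra.Homology.DiscreteRep` (layer statements in
`DiscreteRep.LayerColimit`).  Three definitions with bodies (`comapOpenNormalSubgroup φ hφ V = φ⁻¹V`, the injection
`quotComapMap φ hφ V : H ⧸ φ⁻¹V →* Γ ⧸ V`, the identity-on-vectors layer morphism `comapLayerHom`) and theorems; no named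
fact, no instance, no `sorry`.  The PULL-BACK twin of door-c4 g16's `DiscreteRepLayerRestriction` (`extRes_extInf`,
`LayerColimit.extRes_inflG` for the restriction `resD k U` to a subgroup): here the exact functor is the pull-back
`resDHom k φ hφ : C_Γ ⥤ C_H` along an ARBITRARY continuous homomorphism `φ : H →* Γ` (`DiscreteRepRestrictionExact`) —
not necessarily injective (e.g. a decomposition map `Γ_{K_v} → Γ_K ↠ G_S`).  As in the template the argument is purely
functorial (no acyclicity, no Shapiro): `Inf_V ⋙ φ^* = φ̄^* ⋙ Inf_{φ⁻¹V}` holds definitionally.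

THE STATEMENT.  For `V ≤ Γ` open normal, `M ∈ C_Γ` and `c ∈ Hⁿ(Γ ⧸ V, M^V)`,

  **`φ^* (Inf_V c) = Inf_{φ⁻¹V} (Hⁿ(φ̄, ι) c)`** (`LayerColimit.mapExactFunctor_resDHom_inflG`),

where `φ̄ : H ⧸ φ⁻¹V → Γ ⧸ V` is induced by `φ`, `ι : φ̄^*(M^V) ⟶ (φ^*M)^{φ⁻¹V}` is the identity on vectors, and `Hⁿ(φ̄, ι)` is
Mathlib's `groupCohomology.map` — Serre's compatibility of the maps `f^* : Hⁿ(G, A) → Hⁿ(G', A')` of a compatible pair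
with the limit over open normal subgroups.  Written for brick E3/[P2-mono] of lane «PT-Ш-S-TC» of crux
`stmt-BirchSwinnertonDyer-19032` (cell bsd-eis; scoping `P2-MONO-SCOPING-w3g18.md` §2 P2-d, seat bsd-line-x1-p1-w7 gen 13).
HONEST FRAMING: homological algebra only; no arithmetic statement and no case of BSD is proved here.

## References
* J.-P. Serre, *Galois Cohomology*, Springer (1997), I §2.2 Proposition 8 and §2.4 (compatible pairs, compatibility
  with the limit over open normal subgroups). [SerreGaloisCohomology1997]
* D. Harari, *Galois Cohomology and Class Field Theory*, Universitext (2020), §1.5 Definition 1.33, §4.3 (2)–(3).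
  [Harari2020]
-/

noncomputable section

universe u

namespace Literature.Algebra.Homology

namespace DiscreteRep

open CategoryTheory CategoryTheory.Limits CategoryTheory.Abelian

variable {k Γ H : Type u} [CommRing k] [Group Γ] [TopologicalSpace Γ] [IsTopologicalGroup Γ]
  [Group H] [TopologicalSpace H] [IsTopologicalGroup H] (φ : H →* Γ) (hφ : Continuous φ)
  (V : OpenNormalSubgroup Γ) (M : DiscreteRepCat k Γ)

/-! ## §1 `φ⁻¹V` and the injection `H ⧸ φ⁻¹V →* Γ ⧸ V` -/

omit [IsTopologicalGroup Γ] [IsTopologicalGroup H] in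
/-- **The open normal subgroup `φ⁻¹V ≤ H`** (preimage of the open normal `V ≤ Γ` under the continuous `φ`).
[cite: SerreGaloisCohomology1997, I §2.4][cite: Harari2020, §1.5 Definition 1.33] -/
def comapOpenNormalSubgroup : OpenNormalSubgroup H where
  toSubgroup := (V : Subgroup Γ).comap φ
  isOpen' := (LayerColimit.coe_isOpen V).preimage hφ
  isNormal' := inferInstanceAs ((V : Subgroup Γ).comap φ).Normal

omit [IsTopologicalGroup Γ] [IsTopologicalGroup H] in
/-- Membership in `φ⁻¹V`: `h ∈ φ⁻¹V ↔ φ h ∈ V`. [cite: SerreGaloisCohomology1997, I §2.4] -/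
theorem mem_comapOpenNormalSubgroup_iff (h : H) :
    h ∈ comapOpenNormalSubgroup φ hφ V ↔ φ h ∈ (V : Subgroup Γ) := Iff.rfl

omit [IsTopologicalGroup Γ] [IsTopologicalGroup H] in
/-- `φ⁻¹V` as a subgroup of `H` is `V.comap φ`. [cite: SerreGaloisCohomology1997, I §2.4] -/
theorem coe_comapOpenNormalSubgroup :
    (comapOpenNormalSubgroup φ hφ V : Subgroup H) = (V : Subgroup Γ).comap φ := rfl

omit [IsTopologicalGroup Γ] [IsTopologicalGroup H] in
/-- **The homomorphism `φ̄ : H ⧸ φ⁻¹V →* Γ ⧸ V` induced by `φ`** (injective; an isomorphism onto `φ(H)·V ⧸ V`).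
[cite: SerreGaloisCohomology1997, I §2.4][cite: Harari2020, §1.5 Definition 1.33] -/
def quotComapMap : H ⧸ (comapOpenNormalSubgroup φ hφ V : Subgroup H) →* Γ ⧸ (V : Subgroup Γ) :=
  QuotientGroup.map _ _ φ le_rfl

omit [IsTopologicalGroup Γ] [IsTopologicalGroup H] in
/-- `φ̄ [h] = [φ h]`. [cite: SerreGaloisCohomology1997, I §2.4] -/
@[simp]
theorem quotComapMap_mk (h : H) :
    quotComapMap φ hφ V (QuotientGroup.mk h) = QuotientGroup.mk (φ h) := rfl

omit [IsTopologicalGroup Γ] [IsTopologicalGroup H] in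
/-- `φ̄` is injective (`[φ h] = 1` in `Γ ⧸ V` means `φ h ∈ V`, i.e. `h ∈ φ⁻¹V`). [cite: SerreGaloisCohomology1997, I §2.4] -/
theorem quotComapMap_injective : Function.Injective (quotComapMap φ hφ V) := by
  refine (injective_iff_map_eq_one _).2 fun q hq => ?_
  induction q using QuotientGroup.induction_on with
  | H h =>
    rw [quotComapMap_mk, QuotientGroup.eq_one_iff] at hq
    exact (QuotientGroup.eq_one_iff h).2 ((mem_comapOpenNormalSubgroup_iff φ hφ V h).2 hq)

omit [IsTopologicalGroup Γ] [IsTopologicalGroup H] in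
/-- `φ̄ ∘ mk = mk ∘ φ` as homomorphisms `H →* Γ ⧸ V`. [cite: SerreGaloisCohomology1997, I §2.4] -/
theorem quotComapMap_comp_mk' :
    (quotComapMap φ hφ V).comp (QuotientGroup.mk' (comapOpenNormalSubgroup φ hφ V : Subgroup H)) =
      (QuotientGroup.mk' (V : Subgroup Γ)).comp φ :=
  MonoidHom.ext fun _ => rfl

/-! ## §2 The layer morphism `φ̄^*(M^V) ⟶ (φ^*M)^{φ⁻¹V}` -/

omit [IsTopologicalGroup Γ] [IsTopologicalGroup H] in
/-- A `V`-invariant vector of `M` is a `φ⁻¹V`-invariant vector of `φ^*M`. [cite: SerreGaloisCohomology1997, I §2.4] -/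
theorem mem_invariants_comapLayer (x : M.obj.V)
    (hx : x ∈ Representation.invariants (M.obj.ρ.comp (V : Subgroup Γ).subtype)) :
    x ∈ Representation.invariants
      (((resDHom k φ hφ).obj M).obj.ρ.comp (comapOpenNormalSubgroup φ hφ V : Subgroup H).subtype) := fun w =>
  hx ⟨φ w.1, w.2⟩

omit [IsTopologicalGroup Γ] [IsTopologicalGroup H] in
/-- **The identity-on-vectors morphism `Res_{φ̄}(M^V) ⟶ (φ^*M)^{φ⁻¹V}`** of representations of `H ⧸ φ⁻¹V`.
[cite: SerreGaloisCohomology1997, I §2.2 Proposition 8 and §2.4] -/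
def comapLayerHom :
    Rep.res (quotComapMap φ hφ V) ((invariantsQuotFunctor k (V : Subgroup Γ)).obj M) ⟶
      (invariantsQuotFunctor k (comapOpenNormalSubgroup φ hφ V : Subgroup H)).obj ((resDHom k φ hφ).obj M) :=
  Rep.ofHom
    ⟨{ toFun := fun x => ⟨x.1, mem_invariants_comapLayer φ hφ V M x.1 x.2⟩
       map_add' := fun _ _ => rfl
       map_smul' := fun _ _ => rfl },
     fun q => QuotientGroup.induction_on q fun _ => LinearMap.ext fun _ => Subtype.ext rfl⟩

omit [IsTopologicalGroup Γ] [IsTopologicalGroup H] in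
/-- Formula: `comapLayerHom` is `x ↦ x` on underlying vectors of `M`. [cite: SerreGaloisCohomology1997, I §2.2 Proposition 8] -/
@[simp]
theorem comapLayerHom_hom_apply_coe (x : (M.obj.quotientToInvariants (V : Subgroup Γ)).V) :
    (((comapLayerHom φ hφ V M).hom x).1 : M.obj.V) = x.1 := rfl

omit [IsTopologicalGroup Γ] [IsTopologicalGroup H] in
/-- `comapLayerHom` is injective. [cite: SerreGaloisCohomology1997, I §2.2 Proposition 8] -/
theorem comapLayerHom_injective : Function.Injective (comapLayerHom φ hφ V M).hom := fun _ _ h =>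
  Subtype.ext (congrArg (fun z => (z.1 : M.obj.V)) h)

omit [IsTopologicalGroup Γ] [IsTopologicalGroup H] in
/-- If `V ≤ φ(H)·` — precisely, if every element of `V` is `φ` of an element of `φ⁻¹V`, e.g. `φ` surjective — then
`comapLayerHom` is bijective: `(φ^*M)^{φ⁻¹V}` has the same vectors as `M^V`. [cite: SerreGaloisCohomology1997, I §2.2 Proposition 8] -/
theorem comapLayerHom_bijective (hV : ∀ v ∈ (V : Subgroup Γ), ∃ h : H, φ h = v) :
    Function.Bijective (comapLayerHom φ hφ V M).hom := by
  refine ⟨comapLayerHom_injective φ hφ V M, fun y => ?_⟩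
  refine ⟨⟨y.1, fun v => ?_⟩, Subtype.ext rfl⟩
  obtain ⟨h, hh⟩ := hV v.1 v.2
  have hmem : h ∈ comapOpenNormalSubgroup φ hφ V := by
    rw [mem_comapOpenNormalSubgroup_iff, hh]
    exact v.2
  have hy := y.2 ⟨h, hmem⟩
  change M.obj.ρ (φ h) (y.1 : M.obj.V) = y.1 at hy
  change M.obj.ρ (v.1 : Γ) (y.1 : M.obj.V) = y.1
  rw [← hh]
  exact hy

/-! ## §3 `Inf_V ⋙ φ^* = φ̄^* ⋙ Inf_{φ⁻¹V}` -/

/-- **`Inf_V ⋙ φ^* = Res_{φ̄} ⋙ Inf_{φ⁻¹V}`** as functors `Rep k (Γ ⧸ V) ⥤ C_H` (definitionally: both send `B` to `B`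
with `h ∈ H` acting through `[φ h] ∈ Γ ⧸ V`). [cite: SerreGaloisCohomology1997, I §2.2 Proposition 8, §2.4][cite: Harari2020, §4.3 (2)] -/
theorem infFunctor_comp_resDHom :
    infFunctor k (V : Subgroup Γ) (LayerColimit.coe_isOpen V) ⋙ resDHom k φ hφ =
      Rep.resFunctor (quotComapMap φ hφ V) ⋙
        infFunctor k (comapOpenNormalSubgroup φ hφ V : Subgroup H)
          (LayerColimit.coe_isOpen (comapOpenNormalSubgroup φ hφ V)) := rfl

/-- **`Inf_{φ⁻¹V}(comapLayerHom) ≫ incl_{φ⁻¹V} = φ^* (incl_V)`**: both are the inclusion of the vectors of `M^V` into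
`M`, as morphisms `φ^* (Inf_V (M^V)) ⟶ φ^* M` of `C_H`. [cite: SerreGaloisCohomology1997, I §2.2 Proposition 8] -/
theorem infFunctor_map_comapLayerHom_comp_invariantsIncl :
    (infFunctor k (comapOpenNormalSubgroup φ hφ V : Subgroup H)
          (LayerColimit.coe_isOpen (comapOpenNormalSubgroup φ hφ V))).map (comapLayerHom φ hφ V M) ≫
        invariantsIncl (comapOpenNormalSubgroup φ hφ V : Subgroup H)
          (LayerColimit.coe_isOpen (comapOpenNormalSubgroup φ hφ V)) ((resDHom k φ hφ).obj M) =
      (resDHom k φ hφ).map (invariantsIncl (V : Subgroup Γ) (LayerColimit.coe_isOpen V) M) :=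
  ObjectProperty.hom_ext _ (Rep.hom_ext (DFunLike.ext _ _ fun _ => rfl))

/-! ## §4 Pull-back of an inflated class, on `Ext` -/

section ExtLevel

variable (n : ℕ)

/-- **`φ^* (Inf_V y) = Inf_{φ⁻¹V} (Res_{φ̄} y ≫ comapLayerHom)`** on `Ext`: pulling back along `φ` a class inflated from the
layer `Γ ⧸ V` gives the class inflated (to `H`) from the layer `H ⧸ φ⁻¹V` of the class pulled back along `φ̄ : H ⧸ φ⁻¹V → Γ ⧸ V`.
[cite: SerreGaloisCohomology1997, I §2.2 Proposition 8, §2.4][cite: Harari2020, §1.5 Definition 1.33, §4.3 (3)] -/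
theorem mapExactFunctor_resDHom_extInf
    (y : Ext (Rep.trivial k (Γ ⧸ (V : Subgroup Γ)) k) ((invariantsQuotFunctor k (V : Subgroup Γ)).obj M) n) :
    (extInf (V : Subgroup Γ) (LayerColimit.coe_isOpen V) M n y).mapExactFunctor (resDHom k φ hφ) =
      extInf (comapOpenNormalSubgroup φ hφ V : Subgroup H)
        (LayerColimit.coe_isOpen (comapOpenNormalSubgroup φ hφ V)) ((resDHom k φ hφ).obj M) n
        ((y.mapExactFunctor (Rep.resFunctor (quotComapMap φ hφ V))).comp
          (Ext.mk₀ (comapLayerHom φ hφ V M)) (add_zero n)) := by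
  haveI := comp_preservesFiniteLimits (infFunctor k (V : Subgroup Γ) (LayerColimit.coe_isOpen V)) (resDHom k φ hφ)
  haveI := comp_preservesFiniteColimits (infFunctor k (V : Subgroup Γ) (LayerColimit.coe_isOpen V)) (resDHom k φ hφ)
  haveI := comp_preservesFiniteLimits (Rep.resFunctor (quotComapMap φ hφ V))
    (infFunctor k (comapOpenNormalSubgroup φ hφ V : Subgroup H)
      (LayerColimit.coe_isOpen (comapOpenNormalSubgroup φ hφ V)))
  haveI := comp_preservesFiniteColimits (Rep.resFunctor (quotComapMap φ hφ V))
    (infFunctor k (comapOpenNormalSubgroup φ hφ V : Subgroup H)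
      (LayerColimit.coe_isOpen (comapOpenNormalSubgroup φ hφ V)))
  change ((y.mapExactFunctor (infFunctor k (V : Subgroup Γ) (LayerColimit.coe_isOpen V))).comp
      (Ext.mk₀ (invariantsIncl (V : Subgroup Γ) (LayerColimit.coe_isOpen V) M)) (add_zero n)).mapExactFunctor
      (resDHom k φ hφ) =
    ((((y.mapExactFunctor (Rep.resFunctor (quotComapMap φ hφ V))).comp (Ext.mk₀ (comapLayerHom φ hφ V M))
      (add_zero n)).mapExactFunctor (infFunctor k (comapOpenNormalSubgroup φ hφ V : Subgroup H)
        (LayerColimit.coe_isOpen (comapOpenNormalSubgroup φ hφ V)))).comp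
      (Ext.mk₀ (invariantsIncl (comapOpenNormalSubgroup φ hφ V : Subgroup H)
        (LayerColimit.coe_isOpen (comapOpenNormalSubgroup φ hφ V)) ((resDHom k φ hφ).obj M))) (add_zero n))
  rw [Ext.mapExactFunctor_comp, Ext.mapExactFunctor_comp, Ext.mapExactFunctor_mk₀, Ext.mapExactFunctor_mk₀,
    Ext.comp_assoc_of_third_deg_zero, Ext.mk₀_comp_mk₀, infFunctor_map_comapLayerHom_comp_invariantsIncl,
    ← ExtFunctoriality.mapExactFunctor_comp_functor, ← ExtFunctoriality.mapExactFunctor_comp_functor]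
  rfl

end ExtLevel

/-! ## §5 Pull-back of an inflated class, on the layers `Hⁿ(Γ ⧸ V, M^V)` of (d) -/

namespace LayerColimit

variable (n : ℕ)

/-- **`φ^* (Inf_V c) = Inf_{φ⁻¹V} (Hⁿ(φ̄, comapLayerHom) c)`** for `c ∈ Hⁿ(Γ ⧸ V, M^V)`: in the `groupCohomology`
currency of (d), pulling back to `H` an inflated class is inflating to `H` the image of `c` under Mathlib's
`groupCohomology.map` along `φ̄ : H ⧸ φ⁻¹V → Γ ⧸ V` (the map `f^*` of the compatible pair `(φ̄, ι)`).
[cite: SerreGaloisCohomology1997, I §2.2 Proposition 8, §2.4][cite: Harari2020, §1.5 Definition 1.33, §4.3 (3)] -/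
theorem mapExactFunctor_resDHom_inflG (c : groupCohomology ((invariantsQuotFunctor k (V : Subgroup Γ)).obj M) n) :
    (inflG V M n c).mapExactFunctor (resDHom k φ hφ) =
      inflG (comapOpenNormalSubgroup φ hφ V) ((resDHom k φ hφ).obj M) n
        (groupCohomology.map (quotComapMap φ hφ V) (comapLayerHom φ hφ V M) n c) := by
  rw [inflG_apply, inflG_apply, RepExt.extTrivialAddEquivGroupCohomology_symm_map_comp]
  exact mapExactFunctor_resDHom_extInf φ hφ V M n _

/-- The same together with the injectivity of `φ̄` and — when `V` is reached from `H` (e.g. `φ` onto) — the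
bijectivity of `comapLayerHom` (then the right-hand side is the inflation of the RESTRICTION of `c` to the subgroup
`H ⧸ φ⁻¹V ≅ φ(H)·V ⧸ V ≤ Γ ⧸ V`). [cite: SerreGaloisCohomology1997, I §2.2 Proposition 8] -/
theorem mapExactFunctor_resDHom_inflG_of_surjOn (hV : ∀ v ∈ (V : Subgroup Γ), ∃ h : H, φ h = v)
    (c : groupCohomology ((invariantsQuotFunctor k (V : Subgroup Γ)).obj M) n) :
    (inflG V M n c).mapExactFunctor (resDHom k φ hφ) =
        inflG (comapOpenNormalSubgroup φ hφ V) ((resDHom k φ hφ).obj M) n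
          (groupCohomology.map (quotComapMap φ hφ V) (comapLayerHom φ hφ V M) n c) ∧
      Function.Injective (quotComapMap φ hφ V) ∧ Function.Bijective (comapLayerHom φ hφ V M).hom :=
  ⟨mapExactFunctor_resDHom_inflG φ hφ V M n c, quotComapMap_injective φ hφ V, comapLayerHom_bijective φ hφ V M hV⟩

end LayerColimit

end DiscreteRep

end Literature.Algebra.Homology

end
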